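import Mathlib
import HarnessLib
import HarnessLib.Audit
import Summits.FinalStateConjecture.Statement
import Literature.Geometry.Lorentzian.LinearizedRicci

/-!
Route: FarFieldSynthesis

CLOSED (retired) 2026-08-16T23:47:48Z by planner-rbadge-FinalStateConjecture-FarFieldSy-aa83429c-g2-0 — reason: not-a-thesis: Statement re-typed T2 2026-08-16T21:18Z (IsTameChristodoulouGeneric + RaysStayInClosure + IsFutureOriented); closes rev 2 no longer elaborates and the cruxes conclude the pre-audit property/witness; 1:1 re-typing drafted and D — note: route-repair (planner-rbadge-…-g2-0, 2026-08-16). WHY RETIRED, NOT RE-TYPED. (1) The mechanical repair exists (as ProbeNullTrace rev 4): Q += RaysStayInClosure ∧ IsFutureOriented in NakedThresholds/SettlingThresholds; FarFieldSynthesis' reparametrisation clause → ∃ (e : AFEnd X) F, IsTameDataFamily . The file is kept as the record of this route; refuted decls are indexed as negative knowledge (`ledger negatives`).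

# Route FarFieldSynthesis — four whispers from infinity pierce every first-order threshold at finite
order

It suffices to show X = E ∧ T_N ∧ T_S (route for card whisper-from-infinity-four-wave-synthesis,
re-engineered so that the synthesis
engine is a typed, load-bearing crux). Vocabulary (let-bound verbatim in every item; X fixed, 𝓓 =
admissibleVacuumData X): a KICK through d is
a jointly smooth admissible k-parameter family G with G 0 = d, equal to d off a compact set; a FAR
KICK w.r.t. a compact B ⊆ X is a kick that also
leaves d unchanged ON B (so its developments coincide with MGHD(d) on the whole domain of dependence
of ι(B)); an OBSERVABLE at d is a pair (Φ, ℓ):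
Φ a real function on data, smooth along every kick (REG), whose first derivative along every kick
and every transported development family is
REPRESENTED (REPR) by a linear functional ℓ of the first-order transported metric, pulled back along
a map ψ : ℝ⁴ → MGHD(d) (a chart in practice) landing in the
influence domain of ι(X∖B), ℓ being C^N(S)-continuous for a compact S (CONT) and annihilating
linearised gauge 𝓛_ξ g₀ (GAUGE), and Φ being first-order
non-degenerate along SOME kick (NONDEG). E (FarFieldSynthesis, rank 2, the ENGINE): for every finite
family of observables at d there is a far kick
G w.r.t. B and a direction v such that every Φᵢ(G(t v)) is non-zero on a punctured interval 0 < |t|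
< ε₀ (finite-order non-flatness from infinity, pierced
along a line) and the punctured segments {G(t v) : 0 < |t| < ε} reparametrise, for every ε, to
smooth injective admissible one-parameter families
through d — "whatever an admissible perturbation anywhere moves to first order, four whispers from
beyond B move at finite order". T_N (NakedThresholds,
rank 3) / T_S (SettlingThresholds, rank 4): through every exceptional datum of the censorship resp.
settling stratum pass finitely many observables off
whose common zero set, ALONG FAR KICKS ONLY, the full summit property holds (far-field local
alternative). Three supports are the routine lemmas the
item proofs invoke (the deciding theorem is crux-only): FiniteOrderPiercing (finitely many non-flat
smooth germs on ℝᵏ share a good punctured line —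
pure Mathlib; turns synthesis-non-flatness into E's pierced line), SegmentToCurve (arctan
reparametrisation; E's last clause) and AdmissibleMGHDExists
(= stmt-9937; the (∃ MGHD) half of the property in T_N/T_S).
Lean: `FarFieldSynthesis ∧ NakedThresholds ∧ SettlingThresholds`

## Assembly
Pure logic, crux-only, PROVED sorry-free as the deciding theorem `closes` (Sketch2.lean / glue.lean,
lean check rc 0 on the farm, axioms propext /
Classical.choice / Quot.sound, 2026-08-16): unfold the summit to `HasCodimAtLeastIn 𝓓 {d ∈ 𝓓 | ¬ P
d} 1` with P = (∃ MGHD) ∧ Q; fix X and an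
exceptional d. Either some MGHD of d has incomplete 𝓘⁺ (NakedThresholds) or all MGHDs are complete
and ¬P d (SettlingThresholds); either way we get the
package (𝒟, B, ψ, S, Φᵢ, ℓᵢ, REG, CONT, GAUGE, NONDEG, REPR, far-field alternative concluding P).
FarFieldSynthesis turns it into a far kick G, a
direction v ≠ 0, an ε₀ with all Φᵢ(G(tv)) ≠ 0 for 0 < |t| < ε₀, and the reparametrisation service;
the alternative, pulled back along the continuous
line t ↦ t•v (Metric.eventually_nhds_iff), gives P(G(tv)) for |t| < ε′; reparametrising the
punctured segment of length min ε₀ ε′ yields the smooth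
injective admissible F through d with F c non-exceptional for every c ≠ 0.

Rationale: WHY THIS LINE. Every genericity route on this summit (ProbeNullTrace, LateLocalKicks,
RobustClausewiseGenericity, TameStrataCurveSelection) files as its open crux
"some admissible perturbation crosses the threshold transversally", which at first order from the
far field is adjoint unique continuation for
linearised gravity on an unknown large-data background (false in C^∞ in general: Alinhac–Baouendi;
blocked across the Ionescu–Klainerman
hypersurfaces, Literature.Barriers.FinalStateConjecture.IonescuKlainermanNonExtension) and for late
local kicks is constraint gluing inside an
unknown strong-field region plus backward transport. This line imports the SYNTHESIS half of the
Kurylev–Lassas–Uhlmann inverse-problem technology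
(arXiv:1405.3386, arXiv:1405.4503, doi:10.1002/cpa.21882, arXiv:2411.09354) and its physics twin,
resonant four-wave mixing of gravitational waves
(arXiv:1703.09069: three-wave resonances vanish in vacuum, four-wave interactions are the first
non-trivial resonant process), as an ENGINE: at order
ε₁ε₂ε₃ε₄ four constraint-glued far-field packets (MaoOhTao2023 annular gluing, Sbierski2015 beams)
synthesise a steerable low-frequency linearised
vacuum field at any event reached from outside B, so a continuous, gauge-invariant, far-supported
first variation cannot hide from infinity at every
order; finite order is then enough (FiniteOrderPiercing replaces C¹-transversality, openness,
two-from-one and o-minimality, and is closed under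
conjunction). What no prior route does: the engine is a separately typed statement about the
Einstein flow (no censorship content), and the census
cruxes owe the local alternative ONLY along far kicks, whose developments agree with MGHD(d) on the
domain of dependence of ι(B) — perturbation theory
enters a formed configuration from the radiation zone, the setting of every stability theorem.
Negatives index: one unrelated refuted statement
(PhotonSphereChannels.UniformPhotonSphereChannels).

RANKED CRUXES. #2 FarFieldSynthesis (crux) — FAR-FIELD SYNTHESIS (the engine; card K1+K3 at first
functional order). For every admissible d, every MGHD 𝒟 of d, every compact B ⊆ X, every map ψ : ℝ⁴
→ 𝒟 with image in the influence domain ι(X∖B) ∪ I⁺(ι(X∖B)) ∪ I⁻(ι(X∖B)) (a chart in practice; a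
degenerate ψ only makes the hypotheses vacuous), every compact S ⊆ ℝ⁴ and every finite family (Φᵢ,
ℓᵢ) satisfying REG (Φᵢ ∘ H is C^∞ near 0 for every kick H of d), CONT (|ℓᵢ u| ≤ C·sup_{y∈S, j≤N}
‖Dʲu(y)‖), GAUGE (ℓᵢ kills ψ^*𝓛_ξ g₀ for smooth ξ), NONDEG (some kick H has D(Φᵢ ∘ H)(0) ≠ 0) and
REPR (for every kick H, every transported family g of vacuum developments of H s on an open V ⊇ ι(X)
∪ ψ(ℝ⁴) of 𝒟 — jointly smooth, g 0 = g₀, each g s the pull-back of a development of H s by a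
time-oriented isometric embedding fixing ι — and every direction e: D(Φᵢ ∘ H)(0)e = ℓᵢ(y ↦ ∂_e|₀
ψ^*(g s)(y))), there are ONE far kick G w.r.t. B (G c = d on B and off a compact set) and a
direction v ≠ 0 with every Φᵢ(G(t v)) ≠ 0 for 0 < |t| < ε₀ (synthesis ⇒ non-flat ⇒
FiniteOrderPiercing), the punctured segments {G(t v) : 0 < |t| < ε} reparametrising for every ε > 0
to smooth injective admissible one-parameter families through d (SegmentToCurve). [difficulty:
open-problem] (why it might fail: Order-4 mixing symbol of four DATA-BORNE vacuum packets may be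
pure gauge or invisible to smooth (low-frequency) kernels; non-cancellation against d²Φ…d⁴Φ cross
terms is not controlled by first-variation hypotheses; one exotic background with all-order
invisibility from infinity refutes it.) [arXiv:1405.3386, arXiv:1405.4503, doi:10.1002/cpa.21882,
arXiv:1703.09069, arXiv:2411.09354, MaoOhTao2023, Sbierski2015, doi:10.1090/surv/136,
HawkingEllis1973, IonescuKlainerman2012]
#3 NakedThresholds (crux) — FIRST-ORDER THRESHOLDS, CENSORSHIP STRATUM (card K2+K4, far-field form).
For every admissible d one of whose MGHDs has incomplete future null infinity there are an MGHD 𝒟, a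
compact B, a chart ψ into the influence domain of ι(X∖B), a compact S and finitely many observables
(Φᵢ, ℓᵢ) with REG, CONT, GAUGE, NONDEG, REPR as in FarFieldSynthesis, such that along EVERY far kick
G w.r.t. B, for parameters c near 0, (∀ i, Φᵢ(G c) ≠ 0) ⇒ G c has an MGHD and every MGHD of G c has
complete 𝓘⁺ and an exhaustive sub-extremal Kerr decomposition (the far-field local alternative,
concluding the full summit property). Physics: hyperbolic self-similar naked-singularity profiles
have one unstable direction read on a pre-naked slab inside J⁻ of the first naked point but above
the diamond of B (timing = choice of B), and off the stable manifold the perturbed datum collapses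
or disperses and then settles. [difficulty: open-problem] (why it might fail: Needs the all-data
alternative near a naked point (vacuum instability known only for RSR-type exteriors; smooth-class
spectrum delicate), FIRST-order walls (DSS echoing, flat or laminated thresholds escape) and capture
of the cured datum (full sub-extremal Kerr stability): FSC-hard.) [Christodoulou1999instability,
Christodoulou1999, RodnianskiShlapentokhRothman2023, An2025, LiuLi2018, arXiv:1710.02422,
KehleUnger2024, arXiv:1710.01722]
#4 SettlingThresholds (crux) — FIRST-ORDER THRESHOLDS, SETTLING STRATUM (card K2, far-field form).
For every admissible d all of whose MGHDs have complete 𝓘⁺ but which fails the summit property (no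
MGHD, or one admits no exhaustive sub-extremal finitely-many-Kerr decomposition of its exterior),
the same package: MGHD 𝒟, compact B, chart ψ into the influence domain of ι(X∖B), compact S,
finitely many observables (Φᵢ, ℓᵢ) with REG, CONT, GAUGE, NONDEG, REPR, and the far-field local
alternative (full property) along every far kick w.r.t. B (its prover invokes AdmissibleMGHDExists).
Physics: the asymptotic strata (creep to extremality, hair, parking, non-decay, N = ∞) are read on
late quiet slabs, all of which lie above any diamond; extremality is a first-order wall by the
third-law flux inequality, hair/parking by the projection on the unstable direction of the quiet bad
model. [difficulty: open-problem] (why it might fail: Presumes every censored non-settling end-state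
is a FIRST-order threshold (no open set of non-Kerr ends, no flat creep) and that kicked data off
the walls are captured into charted sub-extremal Kerr — nonlinear Kerr stability on the full range
|a|<M and multi-Kerr recession are open.) [KehleUnger2025, arXiv:2402.10190,
AngelopoulosKehleUnger2024, Aretakis2015, KlainermanSzeftel2023, arXiv:2205.14808,
DafermosHolzegelRodnianskiTaylor2021, arXiv:1710.01722]
#9 FiniteOrderPiercing (support) — FINITE-ORDER LINE PIERCING (card P1; pure analysis, provable now;
the lemma behind the pierced line of FarFieldSynthesis). For k ≥ 1 and finitely many f_i : ℝᵏ → ℝ,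
each C^∞ on a neighbourhood of 0 and not flat at 0 (some iterated Fréchet derivative at 0, possibly
of order 0, is non-zero), there are v ≠ 0 and ε > 0 with f_i(t v) ≠ 0 for all i and all 0 < |t| < ε.
Proof: the lowest non-zero derivative Dⁿⁱf_i(0) is a non-zero symmetric multilinear map, so its
diagonal p_i(v) = Dⁿⁱf_i(0)(v,…,v) is a non-zero homogeneous polynomial (polarisation); pick v
outside the finite union of proper algebraic zero sets; one-variable Taylor gives f_i(t v) = p_i(v)
tⁿⁱ/nᵢ! + o(tⁿⁱ). [difficulty: provable-now] [HormanderALPDO1, Christodoulou1999instability]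
#9 SegmentToCurve (support) — (same statement as ProbeNullTrace.SegmentToCurve,
stmt-FinalStateConjecture-9965; the lemma behind the reparametrisation clause of FarFieldSynthesis,
with 𝓔 := complement of the segment image) a punctured good segment {Φ(tθ) : 0 < |t| < ε} of a
smooth injective k-parameter family of data in 𝓓 reparametrises by arctan to the smooth injective
one-parameter admissible family that `HasCodimAtLeastIn 𝓓 𝓔 1` asks for at Φ(0). [difficulty:
provable-now] [Christodoulou1999, Christodoulou1999instability]
#9 AdmissibleMGHDExists (support) — (verbatim ProbeNullTrace.AdmissibleMGHDExists /
LateLocalKicks.MGHDExists, stmt-FinalStateConjecture-9937) every admissible vacuum datum has a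
maximal globally hyperbolic vacuum development over the repaired structure `VacuumCauchyDevelopment
… IsMaximal` (Choquet-Bruhat–Geroch, Sbierski); shared by every route of the summit. [difficulty:
XL] [ChoquetBruhatGeroch1969CMP, Sbierski2016AHP, Ringstrom2009]

TWO-LAYER PLAN. Foreseen glued splits, nothing filed now. FarFieldSynthesis ⇐ E1 → E2 → E with E1 =
FAR-FIELD JET DENSITY (the order-4 transported jets of
four-packet far kicks, in wave gauge w.r.t. g₀, are C^∞(ψ(S))-dense modulo 𝓛_ξ g₀ among local
linearised vacuum fields near ψ(S): resonant
four-wave mixing / KLU symbol + Runge-type duality) and E2 = JET NON-CANCELLATION (a continuous ℓ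
non-zero on a realised direction is non-zero on
some far order-4 jet, and the ε₁ε₂ε₃ε₄ Taylor coefficient of Φ ∘ G is not cancelled by lower
responses for some packet geometry / width / delay).
NakedThresholds ⇐ N1 → N2 → N with N1 = FIRST-ORDER WALL at a hyperbolic self-similar naked point
(unstable adjoint mode as (Φ, ℓ), timing B inside
J⁻ of the naked point) and N2 = far-field alternative (off the wall: trapped surface or dispersal,
then settle). SettlingThresholds ⇐ S1 → S2 → S
with S1 = extremality / hair walls on quiet late slabs, S2 = capture of kicked sub-threshold data
(imports Kerr stability, possibly as `(h : Fact)`).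

KILL CRITERIA. Refuted:FarFieldSynthesis by a STRUCTURAL witness (a background and a gauge-invariant
continuous far-supported ℓ invisible from infinity at every
order — e.g. the order-4 vacuum mixing symbol identically pure gauge for data-borne packets) closes
the route outright (`close --reason
refuted:FarFieldSynthesis`) and sends the finite-order calculus back to LateLocalKicks as a crux
idea (late local kicks instead of whispers).
Refuted:NakedThresholds / SettlingThresholds by a FLAT or laminated threshold (all jets zero along
every kick) forces a pivot to higher-order
observables (REPR at order j ≤ 4) or to tame curve selection (TameStrataCurveSelection shares the
wall census). Mooted if SwallowTheDatum closes the
typed summit by far-field burial, or if the operator re-types `IsChristodoulouGeneric` with a data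
topology (then far kicks must be small in that
topology — the engine survives, the census must be re-read).

NOT DECOMPOSED YET. The packet construction (Mao–Oh–Tao annular gluing of four beams with injective
amplitudes; existence of transports = Cauchy stability with
parameters on compact slabs — used inside the proofs of E and of NONDEG, never as items), the
wave-gauge bookkeeping of order-4 jets, the
stratification behind T_N / T_S (which observables: adjoint unstable modes of DSS/CSS profiles,
extremality gap, hair projections), the chart
bookkeeping turning "settles" into `FinalStateDecomposition … HasExhaustiveCharts`, and higher-order
(fold) thresholds — all layer 2.

CHEAPEST FALSIFIER. The resonant four-wave mixing symbol in vacuum: expand Ric[η + h] to fourth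
order around four linear TT plane waves with phase-matched null
k₁ + k₂ − k₃ − k₄ = q*, solve orders 2–3 exactly, and test whether the ε₁ε₂ε₃ε₄ e^{iq*·x} source has
a non-zero block transverse to q* (not of
the form q_(μW_ν)). SUBMITTED as kit job j019049 (compute/fourwave.py, exact Fourier-monomial
algebra, Bianchi residuals as self-check; queue
p50 ≈ 1.6 h at submission, result pending at open). Literature prior: in the Hadad–Zakharov 2.5+1
reduction the four-wave interaction coefficient
is non-trivial and three-wave resonances vanish (arXiv:1703.09069, p. 3); identically-zero
transverse block for generic kinematics would kill E for
smooth observables. Second cheapest: a Lean `example` that FarFieldSynthesis is not vacuous-false at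
Minkowski data (all kicks are gauge there, so
NONDEG fails and E holds vacuously — checked by hand, see NOTES.md).

NUMBERS. Orders: three-wave resonant interactions of vacuum GW vanish, four-wave is the first
non-trivial resonant order (arXiv:1703.09069); KLU synthesis
uses the fourth ε-derivative (arXiv:1405.3386 §3–4). Christodoulou's scalar-field instability is a
FIRST-order (even sign-definite) crossing along an
affine 2-plane (Christodoulou1999instability Thm 4.1); Li–Liu order 2 (arXiv:1710.02422). Items: 7
(3 cruxes, 3 supports, 1 assembly);
AdmissibleMGHDExists is the shared item stmt-9937; the deciding theorem is crux-only (rev 1).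

DEFINITION REQUESTS. None needed to STATE the items: `IsSmoothDataFamily`,
`VacuumCauchyDevelopment`, `pullbackBilin`, `lieDerivBilin`, `chronologicalFuture/Past`,
`TimeOrientation.IsFutureDirected`, Mathlib `iteratedFDeriv` / `fderiv` / `IsLocalDiffeomorph` /
`ContMDiffOn` suffice (all elaborated, Sketch2.lean rc 0).
Wanted later (layer 2, not filed now): `WaveGaugeTransport` (canonical transported family in
wave-map gauge w.r.t. g₀, for order-4 jets) under
Summits/FinalStateConjecture/FinalStateConjecture/Theorems.

Novelty: Searches (2026-08-16): pool — all 54 Theses headers + 16 open / 115 closed cards read; grep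
`Kurylev|Lassas|Uhlmann|four-wave|higher-order lineari|synthesis`
over Theses/ (1 unrelated hit, StorageCertificates); `ledger negatives --problem
FinalStateConjecture` (1, unrelated); `lit frontier FinalStateConjecture
--since 2025` (30 rows; none on interaction-driven genericity; read arXiv:2606.07781 pp.1–3); `lit
search --source zbmath "higher order linearization
nonlinear wave equation inverse problem Lorentzian"` (2: arXiv:2106.12257, arXiv:2511.08794 —
inverse problems); `… "Uhlmann Wang determination of
space-time structures from gravitational perturbations"` (1: doi:10.1002/cpa.21882); `… "Galtier
Nazarenko turbulence of weak gravitational waves"`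
(1: arXiv:1803.10719) + `lit read arXiv:1703.09069 pp.1–4` (four-wave theory, p.3); `lit galaxy
search "interaction of gravitational waves" --star all`
(18: Chandrasekhar colliding plane waves, Ferrari–Ibáñez doi:10.1103/PhysRevD.36.1053, textbooks —
exact collisions, no genericity use); openalex / s2 /
arxiv legs rate-limited (HTTP 429, 0 rows; logged). Inherited: the spine card's searches and its
three novelty readers (2026-08-15).
Nearest prior art found: arXiv:1405.3386 / arXiv:1405.4503 / doi:10.1002/cpa.21882 (KLU, KLOU,
Uhlmann–Wang: order-4 synthesis to DETERMINE a
spacetime from measurements); arXiv:1703.09069 (four-wave resonant GW interactions as a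
kinetic/statistical engine); arXiv:2411.09354 (scattering
functionals from  [refs: 10.1002/cpa.21882, 10.1103/PhysRevD.36.1053, 2606.07781, 2106.12257, 2511.08794, 1803.10719, 1703.09069, 1405.3386, 1405.4503, 2411.09354, doi:10.1002/cpa.21882, doi:10.1103/PhysRevD.36.1053]

Barriers (technique_class: higher-order-linearisation, far-field-synthesis): - technique_class: higher-order-linearisation, far-field-synthesis
- Literature.Barriers.FinalStateConjecture.IonescuKlainermanNonExtension: evaded — it (with
Alinhac–Baouendi) kills the FIRST-order version of E (density of far-field linear responses =
adjoint unique continuation across smooth time-dependent vacuum regions); E asks non-flatness at ANY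
order and its proof synthesises the source inside the support of ℓ, so no continuation is performed.
- Literature.Barriers.FinalStateConjecture.nakedSingularityInstability: respected and generalised —
genericity is kept (all statements are per-datum, along kicks); its positive half (Thm 4.1, a
first-order sign-definite crossing along a 2-plane) is the model instance of NakedThresholds with m
= 1.
- Literature.Barriers.FinalStateConjecture.WaveCoordinatesNullConditionFailure: not engaged — wave
gauge is used only for bookkeeping of finite-order jets on compact slabs of a fixed smooth
background, never for global existence.
- Literature.Barriers.FinalStateConjecture.KehrbergerLogarithmicAsymptotics: not engaged — packets
are glued at finite radius outside B; no conformal smoothness of 𝓘⁺ is used (charts ψ sit at finite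
distance).
- Literature.Barriers.FinalStateConjecture.SbierskiTrappingObstruction: harmless — packets cross the
reachable region once, on compact time ranges; trapping of the ADJOINT field is what higher order
makes irrelevant.
- Literature.Barriers.FinalStateConjecture.AretakisInstability: enters SettlingThresholds

History (route lifecycle, newest last):
- 2026-08-16T17:42:19Z · rev 1: restated FarFieldSynthesis (stmt-FinalStateConjecture-15918), NakedThresholds (stmt-FinalStateConjecture-15919), SettlingThresholds (stmt-FinalStateConjecture-15920), Assembly (stmt-FinalStateConjecture-15923) — rev 1 (minutes after open): gate needs_repair glue.non-crux-hypothesis — closes may assume only crux  (planner-plan-novel-FinalStateConjecture-FinalSt-ff139f1f-v2-)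
- 2026-08-16T23:47:48Z · CLOSED retired — not-a-thesis: Statement re-typed T2 2026-08-16T21:18Z (IsTameChristodoulouGeneric + RaysStayInClosure + IsFutureOriented); closes rev 2 no longer elaborates and the cruxes conclude the pre-audit prope (planner-rbadge-FinalStateConjecture-FarFieldSy-aa83429c-g2-0)

sub-problem: FinalStateConjecture · status: closed(retired) · opened planner-plan-novel-FinalStateConjecture-FinalSt-ff139f1f-v2-g3-0 2026-08-16T17:35:38Z · rev 2 · ledger route-FinalStateConjecture-FarFieldSynthesis
GENERATED by the gate from the ledger (D-0016/17). Provers cite these decls: `theorem foo : Summit.FinalStateConjecture.FinalStateConjecture.Theses.FarFieldSynthesis.<Decl> := …` in Summits/FinalStateConjecture/FinalStateConjecture/Theorems/<Name>.lean.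
-/

namespace Summit.FinalStateConjecture.FinalStateConjecture.Theses.FarFieldSynthesis

open scoped BigOperators Topology Manifold Classical MeasureTheory ProbabilityTheory Matrix InnerProductSpace ComplexConjugate ContinuousMap
open Filter Set Function TopologicalSpace MeasureTheory

attribute [summit_statement] _root_.FinalStateConjecture

-- earlier FarFieldSynthesis (stmt-FinalStateConjecture-15918, replaced 2026-08-16T17:42:19Z -> stmt-FinalStateConjecture-16116): retired by None — ∀ (X : Type) [TopologicalSpace X] [ChartedSpace Literature.Geometry.Lorentzian.E3 X] [IsManifold (𝓡 3) ((⊤ : ℕ∞) : WithTop ℕ∞) X] [T2Space X] [SecondCountableTopology X] [ConnectedSpace X], let Dat := Literature.Geometry.Lorentzian.InitialDataSet (𝓡 3) X;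
/-- item stmt-FinalStateConjecture-16116 · crux · rank 2 · closed · moot by None · by planner
why it might fail: Order-4 mixing symbol of four DATA-BORNE vacuum packets may be pure gauge or invisible to smooth (low-frequency) kernels; non-cancellation against d²Φ…d⁴Φ cross terms is not controlled by first-variation hypotheses; one exotic background with all-order invisibility from infinity refutes it.
sources: arXiv:1405.3386, arXiv:1405.4503, doi:10.1002/cpa.21882, arXiv:1703.09069, arXiv:2411.09354, MaoOhTao2023
[crux] FAR-FIELD SYNTHESIS (the engine; card K1+K3 at first functional order). For every admissible
d, every MGHD 𝒟 of d, every compact B ⊆ X, every map ψ : ℝ⁴ → 𝒟 with image in the influence domain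
ι(X∖B) ∪ I⁺(ι(X∖B)) ∪ I⁻(ι(X∖B)) (a chart in practice; a degenerate ψ only makes the hypotheses
vacuous), every compact S ⊆ ℝ⁴ and every finite family (Φᵢ, ℓᵢ) satisfying REG (Φᵢ ∘ H is C^∞ near 0
for every kick H of d), CONT (|ℓᵢ u| ≤ C·sup_{y∈S, j≤N} ‖Dʲu(y)‖), GAUGE (ℓᵢ kills ψ^*𝓛_ξ g₀ for
smooth ξ), NONDEG (some kick H has D(Φᵢ ∘ H)(0) ≠ 0) and REPR (for every kick H, every transported
family g of vacuum developments of H s on an open V ⊇ ι(X) ∪ ψ(ℝ⁴) of 𝒟 — jointly smooth, g 0 = g₀,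
each g s the pull-back of a development of H s by a time-oriented isometric embedding fixing ι — and
every direction e: D(Φᵢ ∘ H)(0)e = ℓᵢ(y ↦ ∂_e|₀ ψ^*(g s)(y))), there are ONE far kick G w.r.t. B (G
c = d on B and off a compact set) and a direction v ≠ 0 with every Φᵢ(G(t v)) ≠ 0 for 0 < |t| < ε₀
(synthesis ⇒ non-flat ⇒ FiniteOrderPiercing), the punctured segments {G(t v) : 0 < |t| < ε}
reparametrising for every ε > 0 to smooth injective admissible one-parameter families through d
(SegmentToCurve). [d -/
@[route_item "route-FinalStateConjecture-FarFieldSynthesis"]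
def FarFieldSynthesis : Prop :=
  ∀ (X : Type) [TopologicalSpace X] [ChartedSpace Literature.Geometry.Lorentzian.E3 X] [IsManifold (𝓡 3) ((⊤ : ℕ∞) : WithTop ℕ∞) X] [T2Space X] [SecondCountableTopology X] [ConnectedSpace X], let Dat := Literature.Geometry.Lorentzian.InitialDataSet (𝓡 3) X; let Adm := Literature.Geometry.Lorentzian.admissibleVacuumData X; ∀ d ∈ Adm, ∀ (𝒟 : Literature.Geometry.Lorentzian.VacuumCauchyDevelopment d), 𝒟.IsMaximal → let Agree : Dat → Dat → Set X → Prop := fun D D' A ↦ ∀ x ∈ A, D'.h.inner x = D.h.inner x ∧ D'.k x = D.k x; let Kick : (k : ℕ) → Dat → (EuclideanSpace ℝ (Fin k) → Dat) → Prop := fun k D G ↦ Literature.Geometry.Lorentzian.InitialDataSet.IsSmoothDataFamily k G ∧ G 0 = D ∧ (∀ c, G c ∈ Adm) ∧ ∃ K : Set X, IsCompact K ∧ ∀ c, Agree D (G c) Kᶜ; let Far : (k : ℕ) → Dat → Set X → (EuclideanSpace ℝ (Fin k) → Dat) → Prop := fun k D B G ↦ Kick k D G ∧ ∀ c, Agree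 D (G c) B; let FB := fun x : 𝒟.carrier ↦ TangentSpace (𝓡 4) x →L[ℝ] TangentSpace (𝓡 4) x →L[ℝ] ℝ; let Fld := Π x, FB x; let Bil := (EuclideanSpace ℝ (Fin 4)) →L[ℝ] (EuclideanSpace ℝ (Fin 4)) →L[ℝ] ℝ; let Tr : (k : ℕ) → (EuclideanSpace ℝ (Fin k) → Dat) → Set 𝒟.carrier → (EuclideanSpace ℝ (Fin k) → Fld) → Prop := fun k H V g ↦ range 𝒟.embed ⊆ V ∧ g 0 = 𝒟.metric.val ∧ ∃ U ∈ 𝓝 (0 : EuclideanSpace ℝ (Fin k)), ContMDiffOn (𝓘(ℝ, EuclideanSpace ℝ (Fin k)).prod (𝓡 4)) ((𝓡 4).prod 𝓘(ℝ, Bil)) ((⊤ : ℕ∞) : WithTop ℕ∞) (fun p : EuclideanSpace ℝ (Fin k) × 𝒟.carrier ↦ Bundle.TotalSpace.mk' Bil (E := FB) p.2 (g p.1 p.2)) (U ×ˢ V) ∧ ∀ s ∈ U, ∃ (𝒟' : Literature.Geometry.Lorentzian.VacuumCauchyDevelopment (H s)) (φ : 𝒟.carrier → 𝒟'.carrier),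 ContMDiffOn (𝓡 4) (𝓡 4) ((⊤ : ℕ∞) : WithTop ℕ∞) φ V ∧ (∀ x ∈ V, Literature.Geometry.Lorentzian.pullbackBilin (I := 𝓡 4) (I' := 𝓡 4) φ 𝒟'.metric.val x = g s x) ∧ (∀ x ∈ V, 𝒟'.timeOrientation.IsFutureDirected (mfderiv (𝓡 4) (𝓡 4) φ x (𝒟.timeOrientation.vectorField x))) ∧ φ ∘ 𝒟.embed = 𝒟'.embed; ∀ (B : Set X), IsCompact B → ∀ (ψ : EuclideanSpace ℝ (Fin 4) → 𝒟.carrier), range ψ ⊆ ((𝒟.embed '' Bᶜ) ∪ 𝒟.metric.chronologicalFuture 𝒟.timeOrientation (𝒟.embed '' Bᶜ) ∪ 𝒟.metric.chronologicalPast 𝒟.timeOrientation (𝒟.embed '' Bᶜ)) → ∀ (S : Set (EuclideanSpace ℝ (Fin 4))), IsCompact S → ∀ (m : ℕ) (Φ : Fin m → Dat → ℝ) (ℓ : Fin m → ((EuclideanSpace ℝ (Fin 4) → Bil) →ₗ[ℝ] ℝ)), (∀ i k H, Kick k d H → ∃ U ∈ 𝓝 (0 : EuclideanSpace ℝ (Fin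 k)), ContDiffOn ℝ ((⊤ : ℕ∞) : WithTop ℕ∞) (Φ i ∘ H) U) → (∀ i, ∃ (C : ℝ) (N : ℕ), ∀ u M, (∀ y ∈ S, ∀ j ≤ N, ‖iteratedFDeriv ℝ j u y‖ ≤ M) → |ℓ i u| ≤ C * M) → (∀ i, ∀ [𝒟.metric.HasLeviCivita], ∀ ξ : ContMDiffSection (𝓡 4) (EuclideanSpace ℝ (Fin 4)) ((⊤ : ℕ∞) : WithTop ℕ∞) (TangentSpace (𝓡 4) : 𝒟.carrier → Type), ℓ i (Literature.Geometry.Lorentzian.pullbackBilin (I := 𝓡 4) (I' := 𝓡 4) ψ (𝒟.metric.lieDerivBilin ξ 𝒟.metric.val)) = 0) → (∀ i, ∃ k H, Kick k d H ∧ fderiv ℝ (Φ i ∘ H) 0 ≠ 0) → (∀ i k H, Kick k d H → ∀ V g, Tr k H V g → range ψ ⊆ V → ∀ e, fderiv ℝ (Φ i ∘ H) 0 e = ℓ i (fun y ↦ fderiv ℝ (fun s ↦ Literature.Geometry.Lorentzian.pullbackBilin (I := 𝓡 4) (I' := 𝓡 4) ψ (g s) y) 0 e)) → ∃ k G, ∃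 v : EuclideanSpace ℝ (Fin k), Far k d B G ∧ v ≠ 0 ∧ (∃ ε₀ : ℝ, 0 < ε₀ ∧ ∀ t : ℝ, t ≠ 0 → |t| < ε₀ → ∀ i, Φ i (G (t • v)) ≠ 0) ∧ (∀ ε : ℝ, 0 < ε → ∃ F : EuclideanSpace ℝ (Fin 1) → Dat, Literature.Geometry.Lorentzian.InitialDataSet.IsSmoothDataFamily 1 F ∧ F 0 = d ∧ Injective F ∧ (∀ c, F c ∈ Adm) ∧ ∀ c, c ≠ 0 → ∃ t : ℝ, t ≠ 0 ∧ |t| < ε ∧ F c = G (t • v))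

-- earlier NakedThresholds (stmt-FinalStateConjecture-15919, replaced 2026-08-16T17:42:19Z -> stmt-FinalStateConjecture-16117): retired by None — ∀ (X : Type) [TopologicalSpace X] [ChartedSpace Literature.Geometry.Lorentzian.E3 X] [IsManifold (𝓡 3) ((⊤ : ℕ∞) : WithTop ℕ∞) X] [T2Space X] [SecondCountableTopology X] [ConnectedSpace X], let Dat := Literature.Geometry.Lorentzian.InitialDataSet (𝓡 3) X; l
/-- item stmt-FinalStateConjecture-16117 · crux · rank 3 · closed · moot by None · by planner
why it might fail: Needs the all-data alternative near a naked point (vacuum instability known only for RSR-type exteriors; smooth-class spectrum delicate), FIRST-order walls (DSS echoing, flat or laminated thresholds escape) and capture of the cured datum (full sub-extremal Kerr stability): FSC-hard.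
sources: Christodoulou1999instability, Christodoulou1999, RodnianskiShlapentokhRothman2023, An2025, LiuLi2018, arXiv:1710.02422
[crux] FIRST-ORDER THRESHOLDS, CENSORSHIP STRATUM (card K2+K4, far-field form). For every admissible
d one of whose MGHDs has incomplete future null infinity there are an MGHD 𝒟, a compact B, a chart ψ
into the influence domain of ι(X∖B), a compact S and finitely many observables (Φᵢ, ℓᵢ) with REG,
CONT, GAUGE, NONDEG, REPR as in FarFieldSynthesis, such that along EVERY far kick G w.r.t. B, for
parameters c near 0, (∀ i, Φᵢ(G c) ≠ 0) ⇒ G c has an MGHD and every MGHD of G c has complete 𝓘⁺ and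
an exhaustive sub-extremal Kerr decomposition (the far-field local alternative, concluding the full
summit property). Physics: hyperbolic self-similar naked-singularity profiles have one unstable
direction read on a pre-naked slab inside J⁻ of the first naked point but above the diamond of B
(timing = choice of B), and off the stable manifold the perturbed datum collapses or disperses and
then settles. [difficulty: open-problem] -/
@[route_item "route-FinalStateConjecture-FarFieldSynthesis"]
def NakedThresholds : Prop :=
  ∀ (X : Type) [TopologicalSpace X] [ChartedSpace Literature.Geometry.Lorentzian.E3 X] [IsManifold (𝓡 3) ((⊤ : ℕ∞) : WithTop ℕ∞) X] [T2Space X] [SecondCountableTopology X] [ConnectedSpace X], let Dat := Literature.Geometry.Lorentzian.InitialDataSet (𝓡 3) X; let Adm := Literature.Geometry.Lorentzian.admissibleVacuumData X; ∀ d ∈ Adm, let Q : Dat → Prop := fun D ↦ ∀ 𝒟 : Literature.Geometry.Lorentzian.VacuumCauchyDevelopment D, 𝒟.IsMaximal → HasCompleteNullInfinity 𝒟.toCauchyDevelopment ∧ ∃ (O : Set 𝒟.carrier) (dd : Literature.Geometry.Lorentzian.FinalStateDecomposition 𝒟.toSpacetime O 2), (∀ i, Literature.Geometry.Lorentzian.Kerr.IsSubextremal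 (dd.mass i) (dd.spin i)) ∧ O = exteriorOf 𝒟.toCauchyDevelopment dd.charted ∧ HasExhaustiveCharts dd; let P : Dat → Prop := fun D ↦ (∃ 𝒟 : Literature.Geometry.Lorentzian.VacuumCauchyDevelopment D, 𝒟.IsMaximal) ∧ Q D; let Agree : Dat → Dat → Set X → Prop := fun D D' A ↦ ∀ x ∈ A, D'.h.inner x = D.h.inner x ∧ D'.k x = D.k x; let Kick : (k : ℕ) → Dat → (EuclideanSpace ℝ (Fin k) → Dat) → Prop := fun k D G ↦ Literature.Geometry.Lorentzian.InitialDataSet.IsSmoothDataFamily k G ∧ G 0 = D ∧ (∀ c, G c ∈ Adm) ∧ ∃ K : Set X, IsCompact K ∧ ∀ c, Agree D (G c) Kᶜ; let Far : (k : ℕ) → Dat → Set X → (EuclideanSpace ℝ (Fin k) → Dat) → Prop := fun k D B G ↦ Kick k D G ∧ ∀ c, Agree D (G c) B; (∃ 𝒟 : Literature.Geometry.Lorentzian.VacuumCauchyDevelopment d, 𝒟.IsMaximal ∧ ¬ HasCompleteNullInfinity 𝒟.toCauchyDevelopment) → ∃ (𝒟 : Literature.Geometry.Lorentzian.VacuumCauchyDevelopment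 d), 𝒟.IsMaximal ∧ (let FB := fun x : 𝒟.carrier ↦ TangentSpace (𝓡 4) x →L[ℝ] TangentSpace (𝓡 4) x →L[ℝ] ℝ; let Fld := Π x, FB x; let Bil := (EuclideanSpace ℝ (Fin 4)) →L[ℝ] (EuclideanSpace ℝ (Fin 4)) →L[ℝ] ℝ; let Tr : (k : ℕ) → (EuclideanSpace ℝ (Fin k) → Dat) → Set 𝒟.carrier → (EuclideanSpace ℝ (Fin k) → Fld) → Prop := fun k H V g ↦ range 𝒟.embed ⊆ V ∧ g 0 = 𝒟.metric.val ∧ ∃ U ∈ 𝓝 (0 : EuclideanSpace ℝ (Fin k)), ContMDiffOn (𝓘(ℝ, EuclideanSpace ℝ (Fin k)).prod (𝓡 4)) ((𝓡 4).prod 𝓘(ℝ, Bil)) ((⊤ : ℕ∞) : WithTop ℕ∞) (fun p : EuclideanSpace ℝ (Fin k) × 𝒟.carrier ↦ Bundle.TotalSpace.mk' Bil (E := FB) p.2 (g p.1 p.2)) (U ×ˢ V) ∧ ∀ s ∈ U, ∃ (𝒟' : Literature.Geometry.Lorentzian.VacuumCauchyDevelopment (H s)) (φ : 𝒟.carrier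 → 𝒟'.carrier), ContMDiffOn (𝓡 4) (𝓡 4) ((⊤ : ℕ∞) : WithTop ℕ∞) φ V ∧ (∀ x ∈ V, Literature.Geometry.Lorentzian.pullbackBilin (I := 𝓡 4) (I' := 𝓡 4) φ 𝒟'.metric.val x = g s x) ∧ (∀ x ∈ V, 𝒟'.timeOrientation.IsFutureDirected (mfderiv (𝓡 4) (𝓡 4) φ x (𝒟.timeOrientation.vectorField x))) ∧ φ ∘ 𝒟.embed = 𝒟'.embed; ∃ (B : Set X), IsCompact B ∧ ∃ (ψ : EuclideanSpace ℝ (Fin 4) → 𝒟.carrier), range ψ ⊆ ((𝒟.embed '' Bᶜ) ∪ 𝒟.metric.chronologicalFuture 𝒟.timeOrientation (𝒟.embed '' Bᶜ) ∪ 𝒟.metric.chronologicalPast 𝒟.timeOrientation (𝒟.embed '' Bᶜ)) ∧ ∃ (S : Set (EuclideanSpace ℝ (Fin 4))), IsCompact S ∧ ∃ (m : ℕ) (Φ : Fin m → Dat → ℝ) (ℓ : Fin m → ((EuclideanSpace ℝ (Fin 4) → Bil) →ₗ[ℝ] ℝ)), (∀ i k H, Kick k d H → ∃ U ∈ 𝓝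 (0 : EuclideanSpace ℝ (Fin k)), ContDiffOn ℝ ((⊤ : ℕ∞) : WithTop ℕ∞) (Φ i ∘ H) U) ∧ (∀ i, ∃ (C : ℝ) (N : ℕ), ∀ u M, (∀ y ∈ S, ∀ j ≤ N, ‖iteratedFDeriv ℝ j u y‖ ≤ M) → |ℓ i u| ≤ C * M) ∧ (∀ i, ∀ [𝒟.metric.HasLeviCivita], ∀ ξ : ContMDiffSection (𝓡 4) (EuclideanSpace ℝ (Fin 4)) ((⊤ : ℕ∞) : WithTop ℕ∞) (TangentSpace (𝓡 4) : 𝒟.carrier → Type), ℓ i (Literature.Geometry.Lorentzian.pullbackBilin (I := 𝓡 4) (I' := 𝓡 4) ψ (𝒟.metric.lieDerivBilin ξ 𝒟.metric.val)) = 0) ∧ (∀ i, ∃ k H, Kick k d H ∧ fderiv ℝ (Φ i ∘ H) 0 ≠ 0) ∧ (∀ i k H, Kick k d H → ∀ V g, Tr k H V g → range ψ ⊆ V → ∀ e, fderiv ℝ (Φ i ∘ H) 0 e = ℓ i (fun y ↦ fderiv ℝ (fun s ↦ Literature.Geometry.Lorentzian.pullbackBilin (I := 𝓡 4) (I' :=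 𝓡 4) ψ (g s) y) 0 e)) ∧ (∀ k G, Far k d B G → ∀ᶠ c in 𝓝 0, (∀ i, Φ i (G c) ≠ 0) → P (G c)))

-- earlier SettlingThresholds (stmt-FinalStateConjecture-15920, replaced 2026-08-16T17:42:19Z -> stmt-FinalStateConjecture-16118): retired by None — ∀ (X : Type) [TopologicalSpace X] [ChartedSpace Literature.Geometry.Lorentzian.E3 X] [IsManifold (𝓡 3) ((⊤ : ℕ∞) : WithTop ℕ∞) X] [T2Space X] [SecondCountableTopology X] [ConnectedSpace X], let Dat := Literature.Geometry.Lorentzian.InitialDataSet (𝓡 3) X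
/-- item stmt-FinalStateConjecture-16118 · crux · rank 4 · closed · moot by None · by planner
why it might fail: Presumes every censored non-settling end-state is a FIRST-order threshold (no open set of non-Kerr ends, no flat creep) and that kicked data off the walls are captured into charted sub-extremal Kerr — nonlinear Kerr stability on the full range |a|<M and multi-Kerr recession are open.
sources: KehleUnger2025, arXiv:2402.10190, AngelopoulosKehleUnger2024, Aretakis2015, KlainermanSzeftel2023, arXiv:2205.14808
[crux] FIRST-ORDER THRESHOLDS, SETTLING STRATUM (card K2, far-field form). For every admissible d
all of whose MGHDs have complete 𝓘⁺ but which fails the summit property (no MGHD, or one admits no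
exhaustive sub-extremal finitely-many-Kerr decomposition of its exterior), the same package: MGHD 𝒟,
compact B, chart ψ into the influence domain of ι(X∖B), compact S, finitely many observables (Φᵢ,
ℓᵢ) with REG, CONT, GAUGE, NONDEG, REPR, and the far-field local alternative (full property) along
every far kick w.r.t. B (its prover invokes AdmissibleMGHDExists). Physics: the asymptotic strata
(creep to extremality, hair, parking, non-decay, N = ∞) are read on late quiet slabs, all of which
lie above any diamond; extremality is a first-order wall by the third-law flux inequality,
hair/parking by the projection on the unstable direction of the quiet bad model. [difficulty:
open-problem] -/
@[route_item "route-FinalStateConjecture-FarFieldSynthesis"]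
def SettlingThresholds : Prop :=
  ∀ (X : Type) [TopologicalSpace X] [ChartedSpace Literature.Geometry.Lorentzian.E3 X] [IsManifold (𝓡 3) ((⊤ : ℕ∞) : WithTop ℕ∞) X] [T2Space X] [SecondCountableTopology X] [ConnectedSpace X], let Dat := Literature.Geometry.Lorentzian.InitialDataSet (𝓡 3) X; let Adm := Literature.Geometry.Lorentzian.admissibleVacuumData X; ∀ d ∈ Adm, let Q : Dat → Prop := fun D ↦ ∀ 𝒟 : Literature.Geometry.Lorentzian.VacuumCauchyDevelopment D, 𝒟.IsMaximal → HasCompleteNullInfinity 𝒟.toCauchyDevelopment ∧ ∃ (O : Set 𝒟.carrier) (dd : Literature.Geometry.Lorentzian.FinalStateDecomposition 𝒟.toSpacetime O 2), (∀ i, Literature.Geometry.Lorentzian.Kerr.IsSubextremal (dd.mass i) (dd.spin i)) ∧ O = exteriorOf 𝒟.toCauchyDevelopment dd.charted ∧ HasExhaustiveCharts dd; let P : Dat → Prop := fun D ↦ (∃ 𝒟 : Literature.Geometry.Lorentzian.VacuumCauchyDevelopment D, 𝒟.IsMaximal) ∧ Q D; let Agree : Dat → Dat → Set X → Prop := fun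 D D' A ↦ ∀ x ∈ A, D'.h.inner x = D.h.inner x ∧ D'.k x = D.k x; let Kick : (k : ℕ) → Dat → (EuclideanSpace ℝ (Fin k) → Dat) → Prop := fun k D G ↦ Literature.Geometry.Lorentzian.InitialDataSet.IsSmoothDataFamily k G ∧ G 0 = D ∧ (∀ c, G c ∈ Adm) ∧ ∃ K : Set X, IsCompact K ∧ ∀ c, Agree D (G c) Kᶜ; let Far : (k : ℕ) → Dat → Set X → (EuclideanSpace ℝ (Fin k) → Dat) → Prop := fun k D B G ↦ Kick k D G ∧ ∀ c, Agree D (G c) B; (∀ 𝒟 : Literature.Geometry.Lorentzian.VacuumCauchyDevelopment d, 𝒟.IsMaximal → HasCompleteNullInfinity 𝒟.toCauchyDevelopment) → ¬ P d → ∃ (𝒟 : Literature.Geometry.Lorentzian.VacuumCauchyDevelopment d), 𝒟.IsMaximal ∧ (let FB := fun x : 𝒟.carrier ↦ TangentSpace (𝓡 4) x →L[ℝ] TangentSpace (𝓡 4) x →L[ℝ] ℝ; let Fld := Π x, FB x; let Bil := (EuclideanSpace ℝ (Fin 4)) →L[ℝ] (EuclideanSpace ℝ (Fin 4)) →L[ℝ]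 ℝ; let Tr : (k : ℕ) → (EuclideanSpace ℝ (Fin k) → Dat) → Set 𝒟.carrier → (EuclideanSpace ℝ (Fin k) → Fld) → Prop := fun k H V g ↦ range 𝒟.embed ⊆ V ∧ g 0 = 𝒟.metric.val ∧ ∃ U ∈ 𝓝 (0 : EuclideanSpace ℝ (Fin k)), ContMDiffOn (𝓘(ℝ, EuclideanSpace ℝ (Fin k)).prod (𝓡 4)) ((𝓡 4).prod 𝓘(ℝ, Bil)) ((⊤ : ℕ∞) : WithTop ℕ∞) (fun p : EuclideanSpace ℝ (Fin k) × 𝒟.carrier ↦ Bundle.TotalSpace.mk' Bil (E := FB) p.2 (g p.1 p.2)) (U ×ˢ V) ∧ ∀ s ∈ U, ∃ (𝒟' : Literature.Geometry.Lorentzian.VacuumCauchyDevelopment (H s)) (φ : 𝒟.carrier → 𝒟'.carrier), ContMDiffOn (𝓡 4) (𝓡 4) ((⊤ : ℕ∞) : WithTop ℕ∞) φ V ∧ (∀ x ∈ V, Literature.Geometry.Lorentzian.pullbackBilin (I := 𝓡 4) (I' := 𝓡 4) φ 𝒟'.metric.val x = g s x) ∧ (∀ x ∈ V, 𝒟'.timeOrientation.IsFutureDirected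 (mfderiv (𝓡 4) (𝓡 4) φ x (𝒟.timeOrientation.vectorField x))) ∧ φ ∘ 𝒟.embed = 𝒟'.embed; ∃ (B : Set X), IsCompact B ∧ ∃ (ψ : EuclideanSpace ℝ (Fin 4) → 𝒟.carrier), range ψ ⊆ ((𝒟.embed '' Bᶜ) ∪ 𝒟.metric.chronologicalFuture 𝒟.timeOrientation (𝒟.embed '' Bᶜ) ∪ 𝒟.metric.chronologicalPast 𝒟.timeOrientation (𝒟.embed '' Bᶜ)) ∧ ∃ (S : Set (EuclideanSpace ℝ (Fin 4))), IsCompact S ∧ ∃ (m : ℕ) (Φ : Fin m → Dat → ℝ) (ℓ : Fin m → ((EuclideanSpace ℝ (Fin 4) → Bil) →ₗ[ℝ] ℝ)), (∀ i k H, Kick k d H → ∃ U ∈ 𝓝 (0 : EuclideanSpace ℝ (Fin k)), ContDiffOn ℝ ((⊤ : ℕ∞) : WithTop ℕ∞) (Φ i ∘ H) U) ∧ (∀ i, ∃ (C : ℝ) (N : ℕ), ∀ u M, (∀ y ∈ S, ∀ j ≤ N, ‖iteratedFDeriv ℝ j u y‖ ≤ M) → |ℓ i u| ≤ C * M) ∧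 (∀ i, ∀ [𝒟.metric.HasLeviCivita], ∀ ξ : ContMDiffSection (𝓡 4) (EuclideanSpace ℝ (Fin 4)) ((⊤ : ℕ∞) : WithTop ℕ∞) (TangentSpace (𝓡 4) : 𝒟.carrier → Type), ℓ i (Literature.Geometry.Lorentzian.pullbackBilin (I := 𝓡 4) (I' := 𝓡 4) ψ (𝒟.metric.lieDerivBilin ξ 𝒟.metric.val)) = 0) ∧ (∀ i, ∃ k H, Kick k d H ∧ fderiv ℝ (Φ i ∘ H) 0 ≠ 0) ∧ (∀ i k H, Kick k d H → ∀ V g, Tr k H V g → range ψ ⊆ V → ∀ e, fderiv ℝ (Φ i ∘ H) 0 e = ℓ i (fun y ↦ fderiv ℝ (fun s ↦ Literature.Geometry.Lorentzian.pullbackBilin (I := 𝓡 4) (I' := 𝓡 4) ψ (g s) y) 0 e)) ∧ (∀ k G, Far k d B G → ∀ᶠ c in 𝓝 0, (∀ i, Φ i (G c) ≠ 0) → P (G c)))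

/-- item stmt-FinalStateConjecture-15921 · support · rank 9 · closed · moot by None · by planner
sources: HormanderALPDO1, Christodoulou1999instability
[support] FINITE-ORDER LINE PIERCING (card P1; pure analysis, provable now). For k ≥ 1 and finitely
many f_i : ℝᵏ → ℝ, each C^∞ on a neighbourhood of 0 and not flat at 0 (some iterated Fréchet
derivative at 0, possibly of order 0, is non-zero), there are v ≠ 0 and ε > 0 with f_i(t v) ≠ 0 for
all i and all 0 < |t| < ε. Proof: the lowest non-zero derivative Dⁿⁱf_i(0) is a non-zero symmetric
multilinear map, so its diagonal p_i(v) = Dⁿⁱf_i(0)(v,…,v) is a non-zero homogeneous polynomial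
(polarisation); pick v outside the finite union of proper algebraic zero sets; one-variable Taylor
gives f_i(t v) = p_i(v) tⁿⁱ/nᵢ! + o(tⁿⁱ). [difficulty: provable-now] -/
@[route_item "route-FinalStateConjecture-FarFieldSynthesis"]
def FiniteOrderPiercing : Prop :=
  ∀ (k : ℕ), 1 ≤ k → ∀ (m : ℕ) (f : Fin m → EuclideanSpace ℝ (Fin k) → ℝ), (∀ i, ∃ U ∈ 𝓝 (0 : EuclideanSpace ℝ (Fin k)), ContDiffOn ℝ ((⊤ : ℕ∞) : WithTop ℕ∞) (f i) U) → (∀ i, ∃ n : ℕ, iteratedFDeriv ℝ n (f i) 0 ≠ 0) → ∃ v : EuclideanSpace ℝ (Fin k), v ≠ 0 ∧ ∃ ε : ℝ, 0 < ε ∧ ∀ t : ℝ, t ≠ 0 → |t| < ε → ∀ i, f i (t • v) ≠ 0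

/-- item stmt-FinalStateConjecture-15922 · support · rank 9 · closed · moot by None · by planner
sources: Christodoulou1999, Christodoulou1999instability
[support] (verbatim ProbeNullTrace.SegmentToCurve, stmt-FinalStateConjecture-9965) a punctured good
segment {Φ(tθ) : 0 < |t| < ε} of a smooth injective k-parameter family of data in 𝓓 reparametrises
by arctan to the smooth injective one-parameter admissible family that `HasCodimAtLeastIn 𝓓 𝓔 1`
asks for at Φ(0). [difficulty: provable-now] -/
@[route_item "route-FinalStateConjecture-FarFieldSynthesis"]
def SegmentToCurve : Prop :=
  ∀ (X : Type) [TopologicalSpace X] [ChartedSpace Literature.Geometry.Lorentzian.E3 X] [IsManifold (𝓡 3) ((⊤ : ℕ∞) : WithTop ℕ∞) X] (𝓓 𝓔 : Set (Literature.Geometry.Lorentzian.InitialDataSet (𝓡 3) X)) (k : ℕ) (Φ : EuclideanSpace ℝ (Fin k) → Literature.Geometry.Lorentzian.InitialDataSet (𝓡 3) X) (θ : EuclideanSpace ℝ (Fin k)) (ε : ℝ), Literature.Geometry.Lorentzian.InitialDataSet.IsSmoothDataFamily k Φ → Function.Injective Φ → (∀ c, Φ c ∈ 𝓓) → θ ≠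 0 → 0 < ε → (∀ t : ℝ, t ≠ 0 → |t| < ε → Φ (t • θ) ∉ 𝓔) → ∃ F : EuclideanSpace ℝ (Fin 1) → Literature.Geometry.Lorentzian.InitialDataSet (𝓡 3) X, Literature.Geometry.Lorentzian.InitialDataSet.IsSmoothDataFamily 1 F ∧ F 0 = Φ 0 ∧ Function.Injective F ∧ (∀ c, F c ∈ 𝓓) ∧ ∀ c, c ≠ 0 → F c ∉ 𝓔

/-- item stmt-FinalStateConjecture-9937 · support · rank 9 · open · by planner
sources: ChoquetBruhatGeroch1969CMP, Sbierski2016AHP, Ringstrom2009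
[support] every admissible datum has a maximal globally hyperbolic vacuum development, stated over
the repaired structure `VacuumCauchyDevelopment` (the corrected form of the deprecated
`choquetBruhat_geroch_exists_mghd`, recorded in `CauchyProblemExistenceDefect`);
Choquet-Bruhat–Geroch 1969 Thm. 3, Sbierski 2016 Thm. 2.6. Known theorem; large formalisation;
shared by every route of this summit. [difficulty: XL] -/
@[route_item "route-FinalStateConjecture-FarFieldSynthesis"]
def AdmissibleMGHDExists : Prop :=
  ∀ (X : Type) [TopologicalSpace X] [ChartedSpace Literature.Geometry.Lorentzian.E3 X] [IsManifold (𝓡 3) ((⊤ : ℕ∞) : WithTop ℕ∞) X] [T2Space X] [SecondCountableTopology X] [ConnectedSpace X], ∀ D ∈ Literature.Geometry.Lorentzian.admissibleVacuumData X, ∃ 𝒟 : Literature.Geometry.Lorentzian.VacuumCauchyDevelopment D, 𝒟.IsMaximal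

-- earlier Assembly (stmt-FinalStateConjecture-15923, replaced 2026-08-16T17:42:19Z -> stmt-FinalStateConjecture-16119): retired by None — FarFieldSynthesis → NakedThresholds → SettlingThresholds → FiniteOrderPiercing → SegmentToCurve → AdmissibleMGHDExists → _root_.FinalStateConjecture
/-- item stmt-FinalStateConjecture-16119 · assembly · rank 1 · closed · moot by None · by planner
sources: Christodoulou1999, arXiv:1710.01722
[assembly] FarFieldSynthesis → NakedThresholds → SettlingThresholds → FinalStateConjecture. -/
@[route_item "route-FinalStateConjecture-FarFieldSynthesis"]
def Assembly : Prop :=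
  FarFieldSynthesis → NakedThresholds → SettlingThresholds → _root_.FinalStateConjecture

end Summit.FinalStateConjecture.FinalStateConjecture.Theses.FarFieldSynthesis
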